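import Mathlib
import Summits.Schanuel.Schanuel.Theorems.RigidCoreMinimalCounterexampleInAclLogSector
import Summits.Schanuel.Schanuel.Theorems.RigidCoreMinimalCounterexampleInAclMateCoeffGrowth
import Summits.Schanuel.Schanuel.Theorems.RigidCoreMinimalCounterexampleInAclMateGrowthVertical

/-!
# Degeneration of the second-level exponential `e^{y₀ y₁}` along the mates — crux stmt-Schanuel-0969

Route `RigidCore`, crux (S*) `MinimalCounterexampleInAcl` (item stmt-Schanuel-0969), line
`kernel-arithmetic-selection` (skeleton gen 19, lead prover-line-stmt-Schanuel-0969-c6-0), registered stub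
`stub_prodExpDegenerate` (the gadget `Φ(y) = e^{y₀ y₁}` of the two-sided selection core), landed
`--supports stmt-Schanuel-0969`.

For a rank-2 first failure `x` (first coordinate transcendental) whose mates `y` with `‖y₁‖` bounded are finitely
many, the second-level exponential `e^{y₀ y₁}` DEGENERATES super-polynomially in `r = ‖y₀‖` along the far mates:
for every `M` there is `R` such that every mate `y` with `‖y₀‖ ≥ R` has `‖e^{y₀y₁}‖ (1+r)^M ≤ 1` or
`‖e^{y₀y₁}‖⁻¹ (1+r)^M ≤ 1`.

Proof.  (a) `stub_mateCoeffGrowth` at `F = Y₀` and `F = Y₁` (values `e^{y₀}`, `e^{y₁}` at `(y, e^y)`, non-zero at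
`x`) bounds `‖e^{yᵢ}‖` above AND below: `C⁻¹ (1+r)^{-D} ≤ ‖e^{yᵢ}‖ ≤ C (1+r)^D` for `r ≥ R`, i.e.
`|Re yᵢ| ≤ log C + D log (1+r) ≤ K (1 + log (1+r))` (`abs_re_le_log_of_two_sided`).
(b) `|Im y₀| ≥ r − |Re y₀|` (`Complex.norm_le_abs_re_add_abs_im`).
(c) `|Im y₁| ≥ 1` on the far mates: the second coordinates of locus points are zeros of one fixed non-zero
exponential polynomial (`MateGrowth.exists_coord_expPoly`), whose zeros with `|Im| ≤ 1` have norm `< R_c`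
(`MateGrowth.norm_lt_of_expPoly_eq_zero_of_im_le`), while the mates with `‖y₁‖ ≤ R_c` are finitely many
(hypothesis), hence have `‖y₀‖ ≤ B`.
(d) `Re (y₀y₁) = Re y₀ Re y₁ − Im y₀ Im y₁` (`Complex.mul_re`), so with `u = log (1+r)`:
`|Re (y₀y₁)| ≥ |Im y₀| |Im y₁| − |Re y₀| |Re y₁| ≥ r − K(1+u) − K²(1+u)² ≥ M u` as soon as
`K(1+u) + K²(1+u)² + M u + 1 ≤ eᵘ = 1 + r` (`exists_budget_le_exp`, explicit threshold via `u³/6 ≤ eᵘ`;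
`mul_log_le_abs_re_mul`).
(e) `‖e^{y₀y₁}‖^{±1} (1+r)^M = exp (±Re (y₀y₁) + M u) ≤ 1` for the right sign (`degenerate_of_mul_log_le_abs`).

Pure real/complex analysis over the landed toolkit (Theorems/…MateCoeffGrowth, …MateGrowth, …MateGrowthVertical);
Mathlib otherwise.
-/

noncomputable section

set_option linter.dupNamespace false

namespace Summit.Schanuel.Schanuel.Cruxes.MinimalCounterexampleInAcl.KernelArithmeticSelection

/-! ## Real-analysis lemmas -/

/-- Exp beats the quadratic budget: for `K, M ≥ 0` there is an (explicit) `U` with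
`K (1+u) + K² (1+u)² + M u + 1 ≤ eᵘ` for all `u ≥ U` (via `u³/6 ≤ eᵘ`). -/
theorem exists_budget_le_exp {K M : ℝ} (hK : 0 ≤ K) (hM : 0 ≤ M) :
    ∃ U : ℝ, ∀ u : ℝ, U ≤ u → K * (1 + u) + K ^ 2 * (1 + u) ^ 2 + M * u + 1 ≤ Real.exp u := by
  refine ⟨max 1 (6 * (1 + 2 * K + 4 * K ^ 2 + M)), fun u hu => ?_⟩
  have hu1 : 1 ≤ u := le_trans (le_max_left _ _) hu
  have hu6 : 6 * (1 + 2 * K + 4 * K ^ 2 + M) ≤ u := le_trans (le_max_right _ _) hu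
  have hu0 : 0 ≤ u := by linarith
  -- `u³/6 ≤ eᵘ`
  have h3 : u ^ 3 / 6 ≤ Real.exp u := by
    have h := Real.pow_div_factorial_le_exp u hu0 3
    norm_num [Nat.factorial] at h
    exact h
  -- the budget is `≤ (1 + 2K + 4K² + M) u² ≤ u³/6`
  have hsq : u ≤ u ^ 2 := by nlinarith
  have hsq1 : (1 : ℝ) ≤ u ^ 2 := by nlinarith
  have h2 : (1 + u) ^ 2 ≤ 4 * u ^ 2 := by
    nlinarith [mul_nonneg (by linarith : (0 : ℝ) ≤ u - 1) (by linarith : (0 : ℝ) ≤ 3 * u + 1)]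
  have hK2 : 0 ≤ K ^ 2 := sq_nonneg K
  have h6 : (1 + 2 * K + 4 * K ^ 2 + M) * u ^ 2 ≤ u ^ 3 / 6 := by
    have h7 : 1 + 2 * K + 4 * K ^ 2 + M ≤ u / 6 := by linarith
    calc (1 + 2 * K + 4 * K ^ 2 + M) * u ^ 2 ≤ u / 6 * u ^ 2 :=
          mul_le_mul_of_nonneg_right h7 (sq_nonneg u)
      _ = u ^ 3 / 6 := by ring
  linarith [mul_le_mul_of_nonneg_left h2 hK2, mul_le_mul_of_nonneg_left hsq hM,
    mul_le_mul_of_nonneg_left hsq hK, mul_le_mul_of_nonneg_left hsq1 hK]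

/-- Two-sided bounds on `‖eˢ‖` squeeze the real part: `‖eˢ‖ ≤ C P` and `C⁻¹ P⁻¹ ≤ ‖eˢ‖` give
`|Re s| ≤ log (C P)`. -/
theorem abs_re_le_log_of_two_sided {s : ℂ} {C P : ℝ} (hC : 0 < C) (hP : 0 < P)
    (hup : ‖Complex.exp s‖ ≤ C * P) (hlow : C⁻¹ * P⁻¹ ≤ ‖Complex.exp s‖) :
    |s.re| ≤ Real.log (C * P) := by
  have hA : 0 < C * P := mul_pos hC hP
  rw [Complex.norm_exp] at hup hlow
  rw [abs_le]
  constructor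
  · have h1 : Real.exp (-s.re) ≤ C * P := by
      rw [Real.exp_neg]
      calc (Real.exp s.re)⁻¹ ≤ (C⁻¹ * P⁻¹)⁻¹ :=
            inv_anti₀ (mul_pos (inv_pos.2 hC) (inv_pos.2 hP)) hlow
        _ = C * P := by rw [mul_inv, inv_inv, inv_inv]
    have h2 := (Real.le_log_iff_exp_le hA).2 h1
    linarith
  · exact (Real.le_log_iff_exp_le hA).2 hup

/-- The real core of the gadget: with `u = log (1+r)`, if the real parts satisfy `|a₀|, |a₁| ≤ K (1+u)`, the
imaginary parts satisfy `r ≤ |a₀| + |b₀|` and `1 ≤ |b₁|`, and `r` is beyond the budget threshold, then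
`M u ≤ |a₀ a₁ − b₀ b₁|` (`= |Re (y₀ y₁)|`). -/
theorem mul_log_le_abs_re_mul {r a₀ b₀ a₁ b₁ K M U : ℝ} (hK : 0 ≤ K)
    (hU : ∀ u : ℝ, U ≤ u → K * (1 + u) + K ^ 2 * (1 + u) ^ 2 + M * u + 1 ≤ Real.exp u)
    (hr : 0 ≤ r) (hUr : Real.exp U ≤ r) (hn : r ≤ |a₀| + |b₀|)
    (ha₀ : |a₀| ≤ K * (1 + Real.log (1 + r))) (ha₁ : |a₁| ≤ K * (1 + Real.log (1 + r)))
    (hb₁ : 1 ≤ |b₁|) : M * Real.log (1 + r) ≤ |a₀ * a₁ - b₀ * b₁| := by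
  have hP : 0 < 1 + r := by linarith
  have hexp : Real.exp (Real.log (1 + r)) = 1 + r := Real.exp_log hP
  have hu0 : 0 ≤ Real.log (1 + r) := Real.log_nonneg (by linarith)
  have hUu : U ≤ Real.log (1 + r) := by
    have h : Real.exp U < Real.exp (Real.log (1 + r)) := by
      rw [hexp]
      linarith
    exact (Real.exp_lt_exp.1 h).le
  have hmain := hU _ hUu
  rw [hexp] at hmain
  have h1 : |b₀| ≤ |b₀| * |b₁| := le_mul_of_one_le_right (abs_nonneg _) hb₁
  have h2 : |a₀| * |a₁| ≤ K * (1 + Real.log (1 + r)) * (K * (1 + Real.log (1 + r))) :=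
    mul_le_mul ha₀ ha₁ (abs_nonneg _) (mul_nonneg hK (by linarith))
  have h3 : |b₀ * b₁| - |a₀ * a₁| ≤ |a₀ * a₁ - b₀ * b₁| := by
    rw [abs_sub_comm]
    exact abs_sub_abs_le_abs_sub _ _
  rw [abs_mul, abs_mul] at h3
  linarith

/-- From `M log (1+r) ≤ |ρ|`: `e^{ρ} (1+r)^M ≤ 1` or `(e^{ρ})⁻¹ (1+r)^M ≤ 1`, according to the sign of `ρ`. -/
theorem degenerate_of_mul_log_le_abs {ρ r : ℝ} {M : ℕ} (hr : 0 ≤ r)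
    (h : (M : ℝ) * Real.log (1 + r) ≤ |ρ|) :
    Real.exp ρ * (1 + r) ^ M ≤ 1 ∨ (Real.exp ρ)⁻¹ * (1 + r) ^ M ≤ 1 := by
  have hP : 0 < 1 + r := by linarith
  have hpow : (1 + r) ^ M = Real.exp ((M : ℝ) * Real.log (1 + r)) := by
    rw [Real.exp_nat_mul, Real.exp_log hP]
  rw [hpow, ← Real.exp_neg, ← Real.exp_add, ← Real.exp_add, Real.exp_le_one_iff, Real.exp_le_one_iff]
  rcases le_or_gt 0 ρ with h0 | h0
  · rw [abs_of_nonneg h0] at h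
    right
    linarith
  · rw [abs_of_neg h0] at h
    left
    linarith

/-! ## The registered stub -/

/-- **Registered stub `stub_prodExpDegenerate` (PROVED) — the gadget `Φ(y) = e^{y₀ y₁}` DEGENERATES
super-polynomially along the far mates of a rank-2 first failure.**  For `x ∈ firstFailures 2` with `x₀`
(and `x₁`) transcendental, if for every `R` the mates `y` of `x` with `‖y₁‖ ≤ R` are finitely many, then for
every `M : ℕ` there is `R` such that every mate `y` with `‖y₀‖ ≥ R` satisfies
`‖e^{y₀ y₁}‖ (1 + ‖y₀‖)^M ≤ 1` or `‖e^{y₀ y₁}‖⁻¹ (1 + ‖y₀‖)^M ≤ 1` (the sign of `Re (y₀ y₁)` depends on the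
mate): `|Re (y₀y₁)| ≥ |Im y₀| |Im y₁| − |Re y₀| |Re y₁|` with `|Re yᵢ| = O(log ‖y₀‖)` (two-sided polynomial size of
`e^{yᵢ}`, `stub_mateCoeffGrowth`), `|Im y₀| ≥ ‖y₀‖ − |Re y₀|` and `|Im y₁| ≥ 1` (vertical escape of the second
coordinate plus the finiteness hypothesis). -/
theorem stub_prodExpDegenerate : ∀ (x : Fin 2 → ℂ), x ∈ Summit.Schanuel.Schanuel.Cruxes.MinimalCounterexampleInAcl.KernelArithmeticSelection.firstFailures 2 → Transcendental ℚ (x 0) → Transcendental ℚ (x 1) → (∀ R : ℝ, Set.Finite {y : Fin 2 → ℂ | y ∈ Summit.Schanuel.Schanuel.Cruxes.MinimalCounterexampleInAcl.KernelArithmeticSelection.locusMates x ∧ ‖y 1‖ ≤ R}) → ∀ M : ℕ, ∃ R : ℝ, ∀ y : Fin 2 → ℂ, y ∈ Summit.Schanuel.Schanuel.Cruxes.MinimalCounterexampleInAcl.KernelArithmeticSelection.locusMates x → R ≤ ‖y 0‖ → (‖Complex.exp (y 0 * y 1)‖ * (1 + ‖y 0‖) ^ M ≤ 1 ∨ ‖Complex.exp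 (y 0 * y 1)‖⁻¹ * (1 + ‖y 0‖) ^ M ≤ 1) := by
  intro x hx hx0 _ hloc1 M
  have htr : Algebra.trdeg ℚ ↥(IntermediateField.adjoin ℚ (Set.range x ∪ Set.range (Complex.exp ∘ x))) <
      (2 : Cardinal) := by
    exact_mod_cast hx.2.1
  -- (a) two-sided polynomial size of `e^{y 0}` and `e^{y 1}` in terms of `‖y 0‖`
  obtain ⟨Ra, Ca, Da, hCa, ha⟩ := stub_mateCoeffGrowth x htr hx0 (MvPolynomial.X (Sum.inr 0))
  obtain ⟨Rb, Cb, Db, hCb, hb⟩ := stub_mateCoeffGrowth x htr hx0 (MvPolynomial.X (Sum.inr 1))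
  -- (c) vertical escape of the second coordinate, and the finiteness hypothesis
  obtain ⟨m, hm0, hm⟩ := MateGrowth.exists_coord_expPoly htr 1
  obtain ⟨Rc, hRc⟩ := MateGrowth.norm_lt_of_expPoly_eq_zero_of_im_le hm0 1
  obtain ⟨B, hB⟩ := ((hloc1 Rc).image fun y : Fin 2 → ℂ => ‖y 0‖).bddAbove
  -- one constant dominating `log Ca`, `log Cb`, `Da`, `Db`
  obtain ⟨K, hK1, hKa, hKb, hKDa, hKDb⟩ : ∃ K : ℝ, 1 ≤ K ∧ Real.log Ca ≤ K ∧ Real.log Cb ≤ K ∧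
      (Da : ℝ) ≤ K ∧ (Db : ℝ) ≤ K :=
    ⟨max (max 1 (max (Real.log Ca) (Real.log Cb))) (max (Da : ℝ) (Db : ℝ)),
      le_trans (le_max_left _ _) (le_max_left _ _),
      le_trans (le_trans (le_max_left _ _) (le_max_right _ _)) (le_max_left _ _),
      le_trans (le_trans (le_max_right _ _) (le_max_right _ _)) (le_max_left _ _),
      le_trans (le_max_left _ _) (le_max_right _ _),
      le_trans (le_max_right _ _) (le_max_right _ _)⟩
  have hK0 : 0 ≤ K := by linarith
  obtain ⟨U, hU⟩ := exists_budget_le_exp (M := (M : ℝ)) hK0 (Nat.cast_nonneg M)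
  refine ⟨max (max Ra Rb) (max (B + 1) (Real.exp U)), fun y hy hR => ?_⟩
  have hmem : y ∈ locusPts x := hy.2
  have hRa : Ra ≤ ‖y 0‖ := le_trans (le_trans (le_max_left _ _) (le_max_left _ _)) hR
  have hRb : Rb ≤ ‖y 0‖ := le_trans (le_trans (le_max_right _ _) (le_max_left _ _)) hR
  have hB1 : B + 1 ≤ ‖y 0‖ := le_trans (le_trans (le_max_left _ _) (le_max_right _ _)) hR
  have hUr : Real.exp U ≤ ‖y 0‖ := le_trans (le_trans (le_max_right _ _) (le_max_right _ _)) hR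
  have hr0 : 0 ≤ ‖y 0‖ := norm_nonneg _
  have hP : 0 < 1 + ‖y 0‖ := by linarith
  have hu0 : 0 ≤ Real.log (1 + ‖y 0‖) := Real.log_nonneg (by linarith)
  -- (a) the real parts are logarithmic in `‖y 0‖`
  obtain ⟨ha1, ha2⟩ := ha y hmem hRa
  obtain ⟨hb1, hb2⟩ := hb y hmem hRb
  simp only [MvPolynomial.aeval_X, Sum.elim_inr, Function.comp_apply] at ha1 ha2 hb1 hb2
  have hre : ∀ (s : ℂ) (C : ℝ) (D : ℕ), 0 < C → Real.log C ≤ K → (D : ℝ) ≤ K →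
      ‖Complex.exp s‖ ≤ C * (1 + ‖y 0‖) ^ D → C⁻¹ * ((1 + ‖y 0‖) ^ D)⁻¹ ≤ ‖Complex.exp s‖ →
      |s.re| ≤ K * (1 + Real.log (1 + ‖y 0‖)) := by
    intro s C D hC hCK hDK hup hlow
    have h := abs_re_le_log_of_two_sided hC (pow_pos hP D) hup hlow
    rw [Real.log_mul hC.ne' (pow_pos hP D).ne', Real.log_pow] at h
    have h' := mul_le_mul_of_nonneg_right hDK hu0
    linarith
  have hre0 := hre (y 0) Ca Da hCa hKa hKDa ha1 (ha2 (Complex.exp_ne_zero _))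
  have hre1 := hre (y 1) Cb Db hCb hKb hKDb hb1 (hb2 (Complex.exp_ne_zero _))
  -- (c) `1 ≤ |Im (y 1)|` on the far mates
  have hfar : Rc < ‖y 1‖ := by
    by_contra hcon
    have hle : ‖y 1‖ ≤ Rc := not_lt.1 hcon
    have hyS : y ∈ {y : Fin 2 → ℂ | y ∈ locusMates x ∧ ‖y 1‖ ≤ Rc} := ⟨hy, hle⟩
    have h : ‖y 0‖ ≤ B := mem_upperBounds.1 hB _ (Set.mem_image_of_mem (fun y : Fin 2 → ℂ => ‖y 0‖) hyS)
    linarith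
  have him1 : 1 ≤ |(y 1).im| := by
    by_contra hcon
    have hlt : |(y 1).im| < 1 := not_le.1 hcon
    have h := hRc (y 1) (hm y hmem) hlt.le
    linarith
  -- (b), (d), (e)
  have hcore := mul_log_le_abs_re_mul hK0 hU hr0 hUr (Complex.norm_le_abs_re_add_abs_im (y 0)) hre0 hre1 him1
  rw [Complex.norm_exp, Complex.mul_re]
  exact degenerate_of_mul_log_le_abs hr0 hcore

end Summit.Schanuel.Schanuel.Cruxes.MinimalCounterexampleInAcl.KernelArithmeticSelection

end
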